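import Summits.QuantumFields.BalabanUV.Beta.GAN24.StencilSlotLamDrift
import Summits.QuantumFields.BalabanUV.Beta.GAN24.StencilSlotLamRoot

/-!
# `BalabanUV.Beta.GAN24.StencilSlotLamDriftRoot` — binder row G-an2-4 / (CONV-C), S-slot AFTER the K-slot: the ROOTED TWIN of `GAN24/StencilSlotLamDrift`
# (p204219) — the DRIFT (`hSall`-shape) of the rooted LAGRANGE summand (P-Λ) over an1's `hessFFAt ρ` (the Λ sector of the literal of record
# `WardLocusRecursive.SrecAt ρ`, and of an2's `SstepNAt ρ` / `SstepAt ρ`) between any two members `k+j+1`, `k+1`, as a FUNCTION OF THE K-SLOT's Cauchy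
# half `CauchyDecayK` — row SR-L0 Λ LINE, DRIFT HALF, of the row owner's `HOME/b2b-balaban-gan24-p1/SKELETON-SREC.md` v0.1 §2; RULINGS-15 (R15-3) «SREC-ROOT»
# (G-an2-4 swarm leaf seat `b2b-balaban-gan24-formalise-leaf-03`, gen 40)

NOT IN PRINT; OUR BOOKKEEPING (the row owner's `gen6/mkroot.py` METHOD: the §3 proof of the base module VERBATIM, the per-bond Hessian entering only through
an1's ROOTED `AveragingHessianKernelsRooted.biLoc_hessFFAt` — box root `r ∈ box (d+1) Lc` — instead of `biLoc_hessFF`; the generic real analysis of the base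
module — `SLam_sub` (linearity of `S^Λ` in its coefficients under decay-supplied summability) and `abs_lamCoeff_sub_le` (the coefficient drift fed by the
K-slot's Cauchy datum) — and `StencilSlotLam.decays_E2unit` are used BY NAME, not re-declared; the rooted units identity is `StencilSlotLamRoot.unitS_lamPiece_eq`).
HONEST FRAMING (cell contract, verbatim): «discharging `BetaPertH` makes Bałaban's UV stability UNCONDITIONAL — a real constructive-QFT result; it is NOT the
continuum limit and NOT the Clay problem.»  HONEST DEPENDENCY (verbatim): «continuum YM on T⁴ ⇐ BetaPertH ∧ nine spine estimates (0/9 proved); BetaPertH ⇐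
(D1) ∧ (D4) ∧ CAP+tail; G-an2-4 gates asym, D1 and NE2/3/4.»  [folklore]; no estimate beyond the base module's, no cited fact, no `def`, no `def … : Prop`,
no sorry.  The K-slot data enter as HYPOTHESES `UnitDecayK … C δ` and `CauchyDecayK … cK θ δ` (`GAN24.CombesThomas`; = the wall's `hK`, `hKall` in the
adopted units; for `d = 3` road P1's outputs `ConvCKWall 3 Lc`) — asserted nowhere here.  Discharges NOTHING of (hS, hSall) on ANY literal: one of three
summands, members `≥ 1` only; 0 wall binders instantiated; NEVER «G-an2-4 closed» as (CONV-C); NOT D1, NOT BetaPertH, NOT continuum, NOT Clay.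

## What is proved (generic `d`; `Lc` with `NeZero Lc`; in-block root `toSite r`, `r ∈ box (d+1) Lc`)
**`locStencil_unitS_lamPiece_sub`**: from `UnitDecayK … C δ`, `CauchyDecayK … cK θ δ`, `0 < δ`, `0 ≤ θ`, `1 ≤ Lc`: for all `k j`,
`LocStencil (normalised rooted Λ-summand of member k+j+1 − normalised rooted Λ-summand of member k+1) (CΛdrift · θ^k) (δ/4)` with the base module's
explicit `k,j`-free `CΛdrift = |cΛ·Lc^{2(d+1)}|·(d+1)·(|Fib d|·(cK·θ·C + C·cK)·Zl(δ/2))·(2ℓ²e^{2(d+1)Lcδ})·Zl(δ/4)` — the `hSall`-shape for this summand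
over the members `≥ 1`, in the K-slot's currency, on the rooted literals.
-/

noncomputable section

open Literature.MathematicalPhysics.QuantumFieldTheory
open Literature.MathematicalPhysics.QuantumFieldTheory.Balaban1983to89
open Literature.MathematicalPhysics.QuantumFieldTheory.Balaban1983to89.Beta
open B12Sec2to5 (l1 l1_nonneg)
open ExpKernelCalculus (MKer Decays BiLoc VertexFamily Zl Zl_nonneg)
open OneStepResolventKernel (Fib LocStencil)
open OneStepKernelFamily (KInvStep)
open AffineAveraging (box toSite)
open InterLevelTransport (SLam locStencil_SLam)
open AveragingHessianKernels (ell)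
open AveragingHessianKernelsRooted (hessFFAt biLoc_hessFFAt)
open BalabanStepJetsSucc (wΛ E2 lamCoeffK abs_lamCoeffK_le)
open Summit.QuantumFields.BalabanUV.Beta.HessKerDressedUnits (unitS)
open Summit.QuantumFields.BalabanUV.Beta.GAN24.CombesThomas (sfStep smStep KStepUnit UnitDecayK CauchyDecayK)
open Summit.QuantumFields.BalabanUV.Beta.GAN24.StencilSlotLam (decays_E2unit)
open Summit.QuantumFields.BalabanUV.Beta.GAN24.StencilSlotLamDrift (SLam_sub abs_lamCoeff_sub_le)
open Summit.QuantumFields.BalabanUV.Beta.GAN24.StencilSlotLamRoot (unitS_lamPiece_eq)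

namespace Summit.QuantumFields.BalabanUV.Beta.GAN24.StencilSlotLamDriftRoot

variable {d : ℕ}

/-! ## The drift of the normalised rooted Lagrange summand (`hSall`-shape for this summand, members `≥ 1`) -/

section Drift

variable {Lc : ℕ} [NeZero Lc]

/-- [folklore] **`hSall`-SHAPE FOR THE ROOTED LAGRANGE SUMMAND, FROM THE K-SLOT** (in-block root `toSite r`, `r ∈ box (d+1) Lc`): uniform decay
`UnitDecayK … C δ` and the Cauchy datum `CauchyDecayK … cK θ δ` of the unit-normalised step resolvents (`0 < δ`, `0 ≤ θ`, `1 ≤ Lc`) bound the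
difference of the normalised rooted (P-Λ) summands of members `k+j+1` and `k+1` in the local-stencil class, rate `δ/4`, with constant `CΛdrift · θ^k`,
`CΛdrift = |cΛ·Lc^{2(d+1)}|·((d+1)·((|Fib d|·(cK·θ·C + C·cK)·Zl(δ−δ/2))·(2ℓ²e^{4(d+1)Lc(δ/2)})·Zl(δ/4)))` (`k,j`-free; base proof verbatim with an1's ROOTED
`biLoc_hessFFAt` as the vertex family). -/
theorem locStencil_unitS_lamPiece_sub (hLc : 1 ≤ Lc) {r : Fin (d + 1) → ℕ} (hr : r ∈ box (d + 1) Lc) {C cK θ δ : ℝ}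
    (hK : UnitDecayK d Lc (sfStep Lc) (smStep d Lc) C δ) (hKall : CauchyDecayK d Lc (sfStep Lc) (smStep d Lc) cK θ δ) (hδ : 0 < δ)
    (hθ : 0 ≤ θ) (cΛ : ℝ) (k j : ℕ) :
    LocStencil
      (fun κ u => unitS (sfStep Lc (k + j + 1)) (smStep d Lc (k + j + 1))
          (fun κ u => (cΛ * wΛ d Lc (k + j + 1)) •
            SLam Lc (lamCoeffK (KInvStep (d := d) Lc (k + j + 1)) (E2 d Lc (k + j + 1)) Lc)
              (fun μ y => hessFFAt (toSite r) Lc μ y) κ u) κ u -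
        unitS (sfStep Lc (k + 1)) (smStep d Lc (k + 1))
          (fun κ u => (cΛ * wΛ d Lc (k + 1)) •
            SLam Lc (lamCoeffK (KInvStep (d := d) Lc (k + 1)) (E2 d Lc (k + 1)) Lc)
              (fun μ y => hessFFAt (toSite r) Lc μ y) κ u) κ u)
      ((|cΛ * (Lc : ℝ) ^ (2 * (d + 1))| *
          ((d + 1 : ℕ) * (((Fintype.card (Fib d) : ℝ) * (cK * θ * C + C * cK) * Zl (d + 1) (δ - δ / 2)) *
            (2 * (ell (d + 1) Lc : ℝ) ^ 2 * Real.exp (4 * ((d : ℝ) + 1) * Lc * (δ / 2))) * Zl (d + 1) (δ / 2 / 2)))) * θ ^ k)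
      (δ / 2 / 2) := by
  rw [unitS_lamPiece_eq, unitS_lamPiece_eq]
  -- data
  have hC : 0 ≤ C := (hK 0).nonneg (Sum.inl 0)
  have hcK : 0 ≤ cK := by
    have h := (hKall 0 0).nonneg (Sum.inl 0)
    simpa using h
  have hδ2 : (0 : ℝ) ≤ δ / 2 := by positivity
  have hQ : VertexFamily (fun μ y => hessFFAt (toSite r) Lc μ y) Lc
      (2 * (ell (d + 1) Lc : ℝ) ^ 2 * Real.exp (4 * ((d : ℝ) + 1) * Lc * (δ / 2))) (δ / 2) :=
    fun μ y => biLoc_hessFFAt hLc μ y hr hδ2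
  -- the two coefficient families and their difference
  set c₁ := lamCoeffK (KStepUnit (d := d) Lc (k + j + 1)) ((smStep d Lc (k + j)) ^ 2 • E2 d Lc (k + j + 1)) Lc with hc₁def
  set c₂ := lamCoeffK (KStepUnit (d := d) Lc (k + 1)) ((smStep d Lc k) ^ 2 • E2 d Lc (k + 1)) Lc with hc₂def
  have hZ : 0 ≤ Zl (d + 1) (δ - δ / 2) := Zl_nonneg (by linarith)
  have hcard : (0 : ℝ) ≤ Fintype.card (Fib d) := Nat.cast_nonneg _
  have hc₁ : ∀ μ y κ u, |c₁ μ y κ u| ≤ ((Fintype.card (Fib d) : ℝ) * (C * C) * Zl (d + 1) (δ - δ / 2)) *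
      Real.exp (-(δ / 2) * l1 ((Lc : ℤ) • y - u)) :=
    abs_lamCoeffK_le (hK (k + j + 1)) (decays_E2unit (hK (k + j)) hδ.le) hδ Lc
  have hc₂ : ∀ μ y κ u, |c₂ μ y κ u| ≤ ((Fintype.card (Fib d) : ℝ) * (C * C) * Zl (d + 1) (δ - δ / 2)) *
      Real.exp (-(δ / 2) * l1 ((Lc : ℤ) • y - u)) :=
    abs_lamCoeffK_le (hK (k + 1)) (decays_E2unit (hK k) hδ.le) hδ Lc
  have hCC : 0 ≤ (Fintype.card (Fib d) : ℝ) * (C * C) * Zl (d + 1) (δ - δ / 2) := by positivity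
  -- the drift bound on the coefficients, with θ^(k+1) + θ^k ≤ (θ + 1) θ^k folded in
  set Cd : ℝ := ((Fintype.card (Fib d) : ℝ) * (cK * θ * C + C * cK) * Zl (d + 1) (δ - δ / 2)) * θ ^ k with hCd
  have hCd0 : 0 ≤ Cd := by positivity
  have hdiff : ∀ μ y κ u, |c₁ μ y κ u - c₂ μ y κ u| ≤ Cd * Real.exp (-(δ / 2) * l1 ((Lc : ℤ) • y - u)) := by
    intro μ y κ u
    refine (abs_lamCoeff_sub_le hK hKall hδ k j μ y κ u).trans (le_of_eq ?_)
    rw [hCd]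
    ring
  -- S^Λ of the difference coefficients is a local stencil family
  have hS := locStencil_SLam (N := Lc) (c := fun μ y κ u => c₁ μ y κ u - c₂ μ y κ u) hdiff hQ (by positivity) hCd0
  -- conclude entrywise
  intro κ u x z a b
  have hlin := SLam_sub (N := Lc) hc₁ hc₂ hQ (by positivity) hCC hCC κ u x z a b
  have hb := hS κ u x z a b
  simp only [Pi.sub_apply, Pi.smul_apply, smul_eq_mul]
  rw [← mul_sub, hlin, abs_mul]
  refine (mul_le_mul_of_nonneg_left hb (abs_nonneg _)).trans (le_of_eq ?_)
  rw [hCd]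
  ring

end Drift

end Summit.QuantumFields.BalabanUV.Beta.GAN24.StencilSlotLamDriftRoot

end
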